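import Summits.BirchSwinnertonDyer.BirchSwinnertonDyer.Theses.KatoDescentPotSupersingular
import Summits.BirchSwinnertonDyer.BirchSwinnertonDyer.Theorems.KatoDescentPotSupersingularWildUpperDefectTowerSurj
import HarnessLib

/-!
# Route `KatoDescentPotSupersingular` (rung K9, cell `bsd-potss`): the GLUE support item
# `WildUpperDefectOfSplit` (stmt-BirchSwinnertonDyer-19192) — the two row cruxes of the reshaped upper
# half U₀ plus the Kato–Tamagawa-exact published inputs give the parent node `WildUpperDefectRankZero`
# (stmt-BirchSwinnertonDyer-19197) BY NAME

Pure bookkeeping over the landed helper of seat `bsd-potss-kmc` (p413281,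
`Theorems/KatoDescentPotSupersingularWildUpperDefectTowerSurj.lean`): on an irreducible rank-`0` O6 row
whose `3`-adic tower image IS surjective, A161″ (Kato 2004 Thm. 14.5 (3) ⊕ Prop. 14.16 (2) in the
Tamagawa-exact, Manin-free reading) + GZK + modularity give the upper half `ord₃ #Ш ≤ ord₃ #Ш_an`
outright (`missingUpperBoundAt_wild_of_towerSurj_of_katoTam`); the remaining irreducible rows are the
tower-NON-surjective ones (`WildUpperNonsurjTower`, item 19189) and the reducible defect rows are
`WildUpperReducibleDefect` (item 19190); the three named facts are bundled as `KatoTamagawaExactInputs`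
(item 19191, cite-only). Nothing about the two row cruxes or the named facts is asserted here: they are
the hypotheses of the glue node, exactly as the route's `closes` consumes it. Honest framing: this
closes a bookkeeping leaf of rung K9 of `BirchSwinnertonDyer`; BSD is not advanced by it.

References: [Kato2004Asterisque] Thm. 14.5 (3) (p. 236), Prop. 14.16 (2) (p. 244), §14.8 (p. 238);
[GreenbergLNM1716] Prop. 4.13; [Wuthrich2014] Lemma 20 (p. 399) (the tower-non-surjective rows at `3`).
-/

set_option autoImplicit false
-- sibling precedent (`KatoDescentPotSupersingularAssembly.lean`): the directory name repeats the summit name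
set_option linter.dupNamespace false

noncomputable section

namespace Summit.BirchSwinnertonDyer.BirchSwinnertonDyer.Theorems

open Summit.BirchSwinnertonDyer.BirchSwinnertonDyer.Theses.KatoDescentPotSupersingular

/-- **The glue node `WildUpperDefectOfSplit` of route `KatoDescentPotSupersingular` holds**:
`WildUpperNonsurjTower → WildUpperReducibleDefect → KatoTamagawaExactInputs → WildUpperDefectRankZero`.
Unfold the node; feed the three components of `KatoTamagawaExactInputs` (A161″, GZK, modularity) and
the two row cruxes to kmc's reshaped composition
`wildUpperDefectRankZero_of_nonsurj_of_redDefect_of_katoTam`, which case-splits a rank-`0` O6 row on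
`E[3]` irreducible / tower-surjective and closes the irreducible tower-surjective rows by
`X4RankZero.missingUpperBoundAt_of_katoTam`. [cite: Kato2004Asterisque, Thm. 14.5 (3) (p. 236), Prop. 14.16 (2) (p. 244)]
[cite: GreenbergLNM1716, §4 Prop. 4.13] -/
theorem wildUpperDefectOfSplit_proof :
    Summit.BirchSwinnertonDyer.BirchSwinnertonDyer.Theses.KatoDescentPotSupersingular.WildUpperDefectOfSplit := by
  intro h₁ h₂ h₃
  exact wildUpperDefectRankZero_of_nonsurj_of_redDefect_of_katoTam h₃.1 h₃.2.1 h₃.2.2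
    (fun W _ _ _ hr hO hI hns => h₁ W hr hO hI hns) (fun W _ _ _ hr hO hI hd => h₂ W hr hO hI hd)

end Summit.BirchSwinnertonDyer.BirchSwinnertonDyer.Theorems

end
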